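/-
Origin: expansion seat `prover-pub-hodgecm-mc-sinst-1-g11-0`, handover #1259 2026-08-21T01:42Z md5 a118f16da344 (138 l.; NEW additive leaf, ns HodgeCM.Model.ThetaAdelicSide: exists_mem_holSatU_clsU_mem_block_archSideOf_two / _three — verbatim #1251's slot-0/1 statements with D := thetaDistDatumTwoOf/ThreeOf …, harm/hd/hCR on lineOmega_two/three … (eta₂/eta₃ …), holSatU hV 2/3, clsU … hV 2/3; proofs := D.exists_mem_holSatU_clsU_mem_block hHD hI h₁ h₃ hA (satG_le_archSideOf_Gfin …) (isLFAction_archSideOf … 2/3) hd hCR χ hχ hι Φf; NAMES for audit: HodgeCM.Model.ThetaAdelicSide.exists_mem_holSatU_clsU_mem_block_archSideOf_two · HodgeCM.Model.ThetaAdelicSide.exists_mem_holSatU_clsU_mem_block_archSideOf_three) (`HOME/mc/pub-hodgecm-mc-sinst-1-g11/stage69/HodgeCM/Model/AdelicThetaDistributionEnd34.lean`, md5 a118f16da344, 138 lines);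
landed by the gen-29 packager (p-g29) in gate run 69 as `HodgeCM/Model/AdelicThetaDistributionEnd34.lean` (verbatim).
-/
/-
Copyright (c) 2026 the pub-hodgecm formalisation cell (harness21).  New file, not vendored.
Origin: session prover-pub-hodgecm-mc-sinst-1-g11-0 (unit pub-hodgecm-mc-sinst-1-g11, S-INSTANCE CONSTRUCTOR gen 11; the (J4) input of `hfam` AT THE
HONEST ADELIC SIDE `archSideOf …`: block membership of the tower classes of the product-type theta forms of slots 2/3 — the conjugated-plane clone of
#1251 `Model/AdelicThetaDistributionEnd`), 2026-08-21.
Intended final place: `HodgeCM/Model/AdelicThetaDistributionEnd34.lean` (NEW additive model-layer leaf; imports sinst-1's `Model/AdelicThetaDistributionEnd`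
(#1251: `satG_le_archSideOf_Gfin`) and `Model/AdelicThetaDistributionOf34` (this kit); nothing imports it; drop alone).
-/
import Summits.HodgeConjecture.HodgeCM.Model.AdelicThetaDistributionEnd
import Summits.HodgeConjecture.HodgeCM.Model.AdelicThetaDistributionOf34

set_option autoImplicit false

/-!
# `hfam` clause 2 at the honest adelic side, slots 2 and 3

For `S := archSideOf V c hGR hGR₀ hGR₁ hGR₂ hGR₃ η hη hηc h₁W A` and `D := thetaDistDatumTwoOf …` (resp. `ThreeOf`): `hGfin` DISCHARGED
(#1251 `satG_le_archSideOf_Gfin`), (LF) `hLF` DISCHARGED (`isLFAction_archSideOf … 2 ∕ 3`), leaving, for the block membership of the tower class of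
`θ(Φarch ℓ ⊗ Φ_f, charInv χ)`: the three archimedean inputs (`Φarch`, `harm` under `lineOmega_two ∕ three`, `hdef`), E's (AN)/(REP′) `hd`/`hCR`
read on `(lineOmega_k, Φarch)`, and `hι`.  Verbatim the slot-0 ∕ 1 statements of #1251 with `Two ∕ Three` data.
KERNEL only: 0 records, 0 `def … : Prop`, nothing cited.
-/

noncomputable section

open NumberField.mixedEmbedding IsDedekindDomain MulAction
open NumberField hiding relNormOneIdeles relNormOneRat probHaarRelNormOneQuot
open scoped Matrix TensorProduct Classical SchwartzMap
open Literature.NumberTheory.Automorphic Literature.NumberTheory.Weil1964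
open Literature.NumberTheory.GelbartRogawski1991 Literature.NumberTheory.GelbartRogawski1991.UnitaryDualPair
open Literature.Geometry.ComplexHyperbolic.BallModel (U21 x₀)
open Literature.AlgebraicGeometry.HodgeTheory Literature.AlgebraicGeometry.ShimuraVarieties
open Literature.NumberTheory.Automorphic.PicardCM
open Literature.NumberTheory.Transcendental (Arapura2012_Cor_15_4_6)
open HodgeCM.Adelic HodgeCM.PerL34 HodgeCM.Model.ArchSideTerm HodgeCM.Model.ThetaDistFin HodgeCM.Model.TowerCarrier
open HodgeCM.Model.SupplyResidual.WeilPairData (charInv)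

namespace HodgeCM.Model
namespace ThetaAdelicSide

variable (hHD : exists_isReal_hodgeModel) (hI : hodgePQ_independent_of_hodgeModel)
  (h₁ : BallQuotientUniformised) (h₃ : CMAbelianVarietyRealised) (hA : Arapura2012_Cor_15_4_6)
variable {L : CMField} {ι₁ : L →+* ℂ} (V : HermSpace3 L ι₁) (c : SeesawCtx L)
  (hGR : (cmSplittingDatum (L : Type) finProdFinEquiv (frameD V) (frameD_real V) (frameD_ne V) (dW c.D) (dW_real c.D)
    (dW_ne c.D)).CompatibleSplitting)
  (hGR₀ : (cmSplittingDatum (L : Type) (e₁) (frameD V) (frameD_real V) (frameD_ne V) (lineVec (L : Type) (dW c.D 0))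
    (fun _ => dW_real c.D 0) (fun _ => dW_ne c.D 0)).CompatibleSplitting)
  (hGR₁ : (cmSplittingDatum (L : Type) (e₁) (frameD V) (frameD_real V) (frameD_ne V) (lineVec (L : Type) (dW c.D 1))
    (fun _ => dW_real c.D 1) (fun _ => dW_ne c.D 1)).CompatibleSplitting)
  (hGR₂ : (cmSplittingDatum (L : Type) (e₁) (frameD V) (frameD_real V) (frameD_ne V) (lineVec (L : Type) (dW' c.D 0))
    (fun _ => dW'_real c.D 0) (fun _ => dW'_ne c.D 0)).CompatibleSplitting)
  (hGR₃ : (cmSplittingDatum (L : Type) (e₁) (frameD V) (frameD_real V) (frameD_ne V) (lineVec (L : Type) (dW' c.D 1))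
    (fun _ => dW'_real c.D 1) (fun _ => dW'_ne c.D 1)).CompatibleSplitting)
  (η : CMAdelic (L : Type) (frameD V) × CMAdelic (L : Type) (dW c.D) →* ℂˣ)
  (hη : ∀ γU ∈ CMRat (L : Type) (frameD V), ∀ γ ∈ CMRat (L : Type) (dW c.D), η (γU, γ) = 1)
  (hηc : Continuous fun p => ((η p : ℂˣ) : ℂ))
  (h₁W : (∀ j, 0 < (ι₁ (dW c.D j)).re) ∨ ∀ j, (ι₁ (dW c.D j)).re < 0)
  (A : ∀ k : Fin 4, ArchLineInput V (lineRepD V c.D hGR hGR₀ hGR₁ hGR₂ hGR₃ η k))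
  (hV : IsAnisotropic L V.Hm)

/-- **`hfam` clause 2 at the honest side, slot 2**: for every finite test vector `Φ_f` and every character `χ` whose `charInv χ` is a weight
function, the theta form `θ(Φarch ℓ ⊗ Φ_f, charInv χ)` of slot 2 of `archSideOf …` lies in `holSatU` and its tower class lies in the block of the
slot's Liu module `Ω(χ) = (D.coinvRep χ).asModule`, `D := thetaDistDatumTwoOf …`. -/
theorem exists_mem_holSatU_clsU_mem_block_archSideOf_two
    (Φarch : Module.Dual ℂ (Fin 2 → ℂ) →ₗ[ℂ] 𝓢((Fin 3 → mixedSpace (↥(maximalRealSubfield L))), ℂ))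
    (harm : ∀ (u : ↥(stabilizer U21 x₀)) (ℓ : Module.Dual ℂ (Fin 2 → ℂ)),
      lineOmega_two V c.D hGR hGR₂ hGR₃ (eta₂ V c.D η) (u : U21) (Φarch ℓ) =
        Φarch ((BallForms.isPullbackCocycle_cotangentCocycle.weightOf x₀).dual u ℓ))
    (hdef : ∀ a : UnitaryGroup.arch (↥(maximalRealSubfield L)) L (IsCMField.complexConj L) 3 V.Hm,
      UnitaryGroup.archAt (↥(maximalRealSubfield L)) L (IsCMField.complexConj L) 3 V.Hm (UnitaryGroup.cmPlace (L : Type) ι₁)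
          (NumberField.complexConj_smul_infinitePlace (L : Type) _) (IsCMField.complexConj_ne_one (L : Type)) a = 1 →
      ∀ (ℓ : Module.Dual ℂ (Fin 2 → ℂ)) (Φf : FinSB (↥(maximalRealSubfield L)) (Fin 3)),
        lineRepOf V c.D hGR hGR₀ hGR₁ hGR₂ hGR₃ (eta₀ V c.D η) (eta₁ V c.D η) (eta₂ V c.D η) (eta₃ V c.D η) 2
            (HodgeCM.Adelic.regimeEquiv L V.Hm hV
              (UnitaryGroup.archToAdelic (↥(maximalRealSubfield L)) L (IsCMField.complexConj L) 3 V.Hm a), 1)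
            (piSchwartzBruhatEquiv (↥(maximalRealSubfield L)) (Fin 3) (Φarch ℓ ⊗ₜ[ℂ] Φf)) =
          piSchwartzBruhatEquiv (↥(maximalRealSubfield L)) (Fin 3) (Φarch ℓ ⊗ₜ[ℂ] Φf))
    (hd : ∀ (T : 𝓢((Fin 3 → mixedSpace (↥(maximalRealSubfield L))), ℂ) →L[ℂ] ℂ) (ℓ : Module.Dual ℂ (Fin 2 → ℂ)),
      DifferentiableAt ℝ (fun b => T (lineOmega_two V c.D hGR hGR₂ hGR₃ (eta₂ V c.D η) (BallForms.expP b) (Φarch ℓ))) 0)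
    (hCR : ∀ (T : 𝓢((Fin 3 → mixedSpace (↥(maximalRealSubfield L))), ℂ) →L[ℂ] ℂ) (ℓ : Module.Dual ℂ (Fin 2 → ℂ)) (v : Fin 2 → ℂ),
      fderiv ℝ (fun b => T (lineOmega_two V c.D hGR hGR₂ hGR₃ (eta₂ V c.D η) (BallForms.expP b) (Φarch ℓ))) 0 (Complex.I • v) =
        Complex.I • fderiv ℝ (fun b => T (lineOmega_two V c.D hGR hGR₂ hGR₃ (eta₂ V c.D η) (BallForms.expP b) (Φarch ℓ))) 0 v)
    {𝓕 : Set C(↥(relNormOneIdeles (↥(maximalRealSubfield L)) L) ⧸ relNormOneRat (↥(maximalRealSubfield L)) L, ℂ)}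
    (χ : PontryaginDual (↥(relNormOneIdeles (↥(maximalRealSubfield L)) L) ⧸ relNormOneRat (↥(maximalRealSubfield L)) L))
    (hχ : charInv χ ∈ 𝓕) (hι : (archSideOf V c hGR hGR₀ hGR₁ hGR₂ hGR₃ η hη hηc h₁W A).ιinf = archInfOf V)
    (Φf : FinSB (↥(maximalRealSubfield L)) (Fin 3)) :
    ∃ hF : (thetaDistDatumTwoOf V c hGR hGR₀ hGR₁ hGR₂ hGR₃ η hη hηc h₁W A hV Φarch harm hdef).dist (charInv χ) Φf ∈
        (archSideOf V c hGR hGR₀ hGR₁ hGR₂ hGR₃ η hη hηc h₁W A).holSatU hV 2 𝓕,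
      (archSideOf V c hGR hGR₀ hGR₁ hGR₂ hGR₃ η hη hηc h₁W A).clsU hHD hI h₁ h₃ hA 𝓕 hι hV 2
          ⟨(thetaDistDatumTwoOf V c hGR hGR₀ hGR₁ hGR₂ hGR₃ η hη hηc h₁W A hV Φarch harm hdef).dist (charInv χ) Φf, hF⟩ ∈
        ⨆ ψ : ((thetaDistDatumTwoOf V c hGR hGR₀ hGR₁ hGR₂ hGR₃ η hη hηc h₁W A hV Φarch harm hdef).coinvRep χ).asModule
            →ₗ[MonoidAlgebra ℂ ↥V.adelicFin] Tower hHD hI (ballQuotientUniformisedDatum_of h₁) h₃ hA V,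
          (LinearMap.range ψ).restrictScalars ℂ :=
  (thetaDistDatumTwoOf V c hGR hGR₀ hGR₁ hGR₂ hGR₃ η hη hηc h₁W A hV Φarch harm hdef).exists_mem_holSatU_clsU_mem_block hHD hI h₁ h₃ hA
    (satG_le_archSideOf_Gfin V c hGR hGR₀ hGR₁ hGR₂ hGR₃ η hη hηc h₁W A hV)
    (isLFAction_archSideOf V c hGR hGR₀ hGR₁ hGR₂ hGR₃ η hη hηc h₁W A 2) hd hCR χ hχ hι Φf

/-- **`hfam` clause 2 at the honest side, slot 3**: for every finite test vector `Φ_f` and every character `χ` whose `charInv χ` is a weight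
function, the theta form `θ(Φarch ℓ ⊗ Φ_f, charInv χ)` of slot 3 of `archSideOf …` lies in `holSatU` and its tower class lies in the block of the
slot's Liu module `Ω(χ) = (D.coinvRep χ).asModule`, `D := thetaDistDatumThreeOf …`. -/
theorem exists_mem_holSatU_clsU_mem_block_archSideOf_three
    (Φarch : Module.Dual ℂ (Fin 2 → ℂ) →ₗ[ℂ] 𝓢((Fin 3 → mixedSpace (↥(maximalRealSubfield L))), ℂ))
    (harm : ∀ (u : ↥(stabilizer U21 x₀)) (ℓ : Module.Dual ℂ (Fin 2 → ℂ)),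
      lineOmega_three V c.D hGR hGR₂ hGR₃ (eta₃ V c.D η) (u : U21) (Φarch ℓ) =
        Φarch ((BallForms.isPullbackCocycle_cotangentCocycle.weightOf x₀).dual u ℓ))
    (hdef : ∀ a : UnitaryGroup.arch (↥(maximalRealSubfield L)) L (IsCMField.complexConj L) 3 V.Hm,
      UnitaryGroup.archAt (↥(maximalRealSubfield L)) L (IsCMField.complexConj L) 3 V.Hm (UnitaryGroup.cmPlace (L : Type) ι₁)
          (NumberField.complexConj_smul_infinitePlace (L : Type) _) (IsCMField.complexConj_ne_one (L : Type)) a = 1 →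
      ∀ (ℓ : Module.Dual ℂ (Fin 2 → ℂ)) (Φf : FinSB (↥(maximalRealSubfield L)) (Fin 3)),
        lineRepOf V c.D hGR hGR₀ hGR₁ hGR₂ hGR₃ (eta₀ V c.D η) (eta₁ V c.D η) (eta₂ V c.D η) (eta₃ V c.D η) 3
            (HodgeCM.Adelic.regimeEquiv L V.Hm hV
              (UnitaryGroup.archToAdelic (↥(maximalRealSubfield L)) L (IsCMField.complexConj L) 3 V.Hm a), 1)
            (piSchwartzBruhatEquiv (↥(maximalRealSubfield L)) (Fin 3) (Φarch ℓ ⊗ₜ[ℂ] Φf)) =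
          piSchwartzBruhatEquiv (↥(maximalRealSubfield L)) (Fin 3) (Φarch ℓ ⊗ₜ[ℂ] Φf))
    (hd : ∀ (T : 𝓢((Fin 3 → mixedSpace (↥(maximalRealSubfield L))), ℂ) →L[ℂ] ℂ) (ℓ : Module.Dual ℂ (Fin 2 → ℂ)),
      DifferentiableAt ℝ (fun b => T (lineOmega_three V c.D hGR hGR₂ hGR₃ (eta₃ V c.D η) (BallForms.expP b) (Φarch ℓ))) 0)
    (hCR : ∀ (T : 𝓢((Fin 3 → mixedSpace (↥(maximalRealSubfield L))), ℂ) →L[ℂ] ℂ) (ℓ : Module.Dual ℂ (Fin 2 → ℂ)) (v : Fin 2 → ℂ),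
      fderiv ℝ (fun b => T (lineOmega_three V c.D hGR hGR₂ hGR₃ (eta₃ V c.D η) (BallForms.expP b) (Φarch ℓ))) 0 (Complex.I • v) =
        Complex.I • fderiv ℝ (fun b => T (lineOmega_three V c.D hGR hGR₂ hGR₃ (eta₃ V c.D η) (BallForms.expP b) (Φarch ℓ))) 0 v)
    {𝓕 : Set C(↥(relNormOneIdeles (↥(maximalRealSubfield L)) L) ⧸ relNormOneRat (↥(maximalRealSubfield L)) L, ℂ)}
    (χ : PontryaginDual (↥(relNormOneIdeles (↥(maximalRealSubfield L)) L) ⧸ relNormOneRat (↥(maximalRealSubfield L)) L))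
    (hχ : charInv χ ∈ 𝓕) (hι : (archSideOf V c hGR hGR₀ hGR₁ hGR₂ hGR₃ η hη hηc h₁W A).ιinf = archInfOf V)
    (Φf : FinSB (↥(maximalRealSubfield L)) (Fin 3)) :
    ∃ hF : (thetaDistDatumThreeOf V c hGR hGR₀ hGR₁ hGR₂ hGR₃ η hη hηc h₁W A hV Φarch harm hdef).dist (charInv χ) Φf ∈
        (archSideOf V c hGR hGR₀ hGR₁ hGR₂ hGR₃ η hη hηc h₁W A).holSatU hV 3 𝓕,
      (archSideOf V c hGR hGR₀ hGR₁ hGR₂ hGR₃ η hη hηc h₁W A).clsU hHD hI h₁ h₃ hA 𝓕 hι hV 3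
          ⟨(thetaDistDatumThreeOf V c hGR hGR₀ hGR₁ hGR₂ hGR₃ η hη hηc h₁W A hV Φarch harm hdef).dist (charInv χ) Φf, hF⟩ ∈
        ⨆ ψ : ((thetaDistDatumThreeOf V c hGR hGR₀ hGR₁ hGR₂ hGR₃ η hη hηc h₁W A hV Φarch harm hdef).coinvRep χ).asModule
            →ₗ[MonoidAlgebra ℂ ↥V.adelicFin] Tower hHD hI (ballQuotientUniformisedDatum_of h₁) h₃ hA V,
          (LinearMap.range ψ).restrictScalars ℂ :=
  (thetaDistDatumThreeOf V c hGR hGR₀ hGR₁ hGR₂ hGR₃ η hη hηc h₁W A hV Φarch harm hdef).exists_mem_holSatU_clsU_mem_block hHD hI h₁ h₃ hA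
    (satG_le_archSideOf_Gfin V c hGR hGR₀ hGR₁ hGR₂ hGR₃ η hη hηc h₁W A hV)
    (isLFAction_archSideOf V c hGR hGR₀ hGR₁ hGR₂ hGR₃ η hη hηc h₁W A 3) hd hCR χ hχ hι Φf

end ThetaAdelicSide
end HodgeCM.Model

end
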